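import Mathlib
import HarnessLib
import Literature.AlgebraicGeometry.Resolution.BlowupsExistence
import Literature.AlgebraicGeometry.Resolution.BlowupsProperProofs
import Literature.AlgebraicGeometry.Resolution.BlowupsIntegral
import Literature.AlgebraicGeometry.Resolution.AffineBlowupCartier
import Literature.AlgebraicGeometry.Resolution.AlterationsNormalizationReduction
import Literature.AlgebraicGeometry.Resolution.AlterationsResolution
import Literature.AlgebraicGeometry.Resolution.MarkedIdealsLemmas
import Literature.AlgebraicGeometry.Resolution.IdealSheafLemmas
import Literature.AlgebraicGeometry.Resolution.ProperBirationalGlobalSections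
import Summits.ResolutionOfSingularities.ResolutionOfSingularities.Theorems.HomologicalConductorNoZenoResolutionThrough

/-!
# Route `HomologicalConductor`, kill test `SurfaceTermination` (stmt-ResolutionOfSingularities-16488):
# a resolution DOMINATING a given one on which a given ideal becomes invertible (mod CJS-General)

OURS (cell res-hironaka, crux chain W4.4, seat res-L0-w44-stub-1; object U2a «chart dictionary», piece (K1)
of res-D-pv-045's programme `stub_pgNonincreasing`, PG-LERAY-NOTE §1 (K1); res-L0-w44-plan-1 (ρ13a));
nothing here is a statement of the manuscript under review (Hironaka 2017); AI-written, weaker than expert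
review.  SUPPORT-level (kill test K4.4-s), counted 0.

For an excellent Noetherian domain `R` of dimension `≤ 2`, a non-zero ideal `I ⊆ R` and ANY resolution
`ξ : X ⟶ Spec R`, there is a resolution `ρ : Z ⟶ Spec R` together with a proper birational `τ : Z ⟶ X` over
`Spec R` such that `I · 𝒪_Z` is invertible (`IsEffectiveCartier ((affineBlowup.idealSheaf I).comap ρ)`,
so that `ρ` lifts to the blowing up `Bl_I(Spec R)` by `IsBlowup.lift`) —
`exists_isResolution_dominating_of_cjsGeneral`, modulo the named fact `CossartJannsenSaito2020General`
(Cossart–Jannsen–Saito 2020, Thm. 1.2).  Construction: blow `X` up along `I · 𝒪_X` (tree `exists_isBlowup`,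
proper `IsBlowup.isProper`, integral and birational since `I · 𝒪_X ≠ 0` — `comap_ne_bot_of_isDominant`),
resolve the blow-up `X₁` by Cossart–Jannsen–Saito (excellent of dimension `2`: finite type over `R`, tree
`isExcellentRing_sections_of_locallyOfFiniteType`, `IsBirational.topologicalKrullDim_eq_of_isProper`), and
pull the invertible ideal `I · 𝒪_{X₁}` back along the dominant `Z ⟶ X₁` (tree
`IsEffectiveCartier.comap_of_isDominant`).  Def-free.

References: V. Cossart, U. Jannsen, S. Saito, LNM 2270 (2020), Thm. 1.2 [`CossartJannsenSaito2020`];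
U. Görtz, T. Wedhorn, *Algebraic Geometry I* (2020), Def. 13.90, Prop. 13.92, 13.96 [`GortzWedhorn2020`];
A. J. de Jong, Publ. Math. IHÉS 83 (1996), 4.10 [`DeJong1996`].
-/

noncomputable section

-- single-problem summit: the doubled namespace component `ResolutionOfSingularities` is forced
set_option linter.dupNamespace false

namespace Summit.ResolutionOfSingularities.ResolutionOfSingularities.Theorems.SurfaceTermination.ChartResolution

open CategoryTheory CategoryTheory.Limits AlgebraicGeometry TopologicalSpace Opposite
open Literature.AlgebraicGeometry.Resolution Literature.AlgebraicGeometry.Motives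
open Literature.AlgebraicGeometry.Morphisms

/-! ## `I · 𝒪_X ≠ 0` -/

/-- **`I · 𝒪_X ≠ 0`** for `I ≠ 0` and `ξ : X ⟶ Spec R` dominant with `X` integral, `R` a domain and the
stalk map at the generic point an isomorphism (e.g. `ξ` birational): a non-zero `c ∈ I` has non-zero image
in `K(X) = Frac R` (tree `isFractionRing_baseToFunctionField`), which is the generic germ of the section
`ξ^*(c)|_V ∈ (I · 𝒪_X)(V)` on any affine open `V` (tree `ideal_comap_of_le`). [folklore] -/
theorem comap_ne_bot_of_isDominant {R : Type} [CommRing R] [IsDomain R] {X : Scheme.{0}} [IsIntegral X]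
    (ξ : X ⟶ Spec (.of R)) [IsDominant ξ] (hstalk : IsIso (ξ.stalkMap (genericPoint X)))
    (I : Ideal R) (hI : I ≠ ⊥) :
    (affineBlowup.idealSheaf I).comap ξ ≠ ⊥ := by
  intro hJ
  obtain ⟨c, hcI, hc0⟩ := Submodule.exists_mem_ne_zero_of_ne_bot hI
  -- a (non-empty) affine open of `X`
  obtain ⟨x⟩ := (inferInstance : Nonempty X)
  obtain ⟨V, hV, hxV, -⟩ := exists_isAffineOpen_mem_and_subset (X := X) (x := x) (U := ⊤) trivial
  have hVle : (V : X.Opens) ≤ ξ ⁻¹ᵁ ((⟨⊤, isAffineOpen_top _⟩ : (Spec (.of R)).affineOpens) : _) := le_top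
  -- `(I · 𝒪_X)(V) = I · Γ(X, V) = 0`
  have h1 := ideal_comap_of_le ξ (affineBlowup.idealSheaf I) ⟨⊤, isAffineOpen_top _⟩ ⟨V, hV⟩ hVle
  rw [hJ, Scheme.IdealSheafData.ideal_bot, Pi.bot_apply] at h1
  have hc : ξ.appLE ⊤ V hVle ((Scheme.ΓSpecIso (.of R)).inv c) ∈
      ((affineBlowup.idealSheaf I).ideal ⟨⊤, isAffineOpen_top _⟩).map (ξ.appLE ⊤ V hVle).hom := by
    refine Ideal.mem_map_of_mem _ ?_
    rw [affineBlowup.idealSheaf, ideal_ofIdealTop_top]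
    exact Ideal.mem_map_of_mem _ hcI
  rw [← h1] at hc
  have hc' : ξ.appLE ⊤ V hVle ((Scheme.ΓSpecIso (.of R)).inv c) = 0 := hc
  -- its generic germ is the image of `c` in `K(X) = Frac R`
  have hη : genericPoint X ∈ (V : X.Opens) :=
    ((genericPoint_spec X).mem_open_set_iff V.isOpen).mpr (by simpa using ⟨x, hxV⟩)
  have hgerm : baseToFunctionField ξ c =
      X.presheaf.germ V (genericPoint X) hη (ξ.appLE ⊤ V hVle ((Scheme.ΓSpecIso (.of R)).inv c)) := by
    rw [Scheme.Hom.appLE, CommRingCat.comp_apply]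
    erw [TopCat.Presheaf.germ_res_apply]
    rfl
  rw [hc', map_zero] at hgerm
  letI := (baseToFunctionField ξ).toAlgebra
  haveI : IsFractionRing R X.functionField := isFractionRing_baseToFunctionField ξ hstalk
  exact hc0 ((IsFractionRing.injective R X.functionField) (by rw [map_zero]; exact hgerm))

/-! ## The dominating resolution -/

/-- **A resolution dominating a given one on which a given ideal becomes invertible** (modulo
Cossart–Jannsen–Saito).  `R` an excellent Noetherian domain of dimension `≤ 2`, `I ≠ 0` an ideal,
`ξ : X ⟶ Spec R` a resolution.  Then there are a resolution `ρ : Z ⟶ Spec R` and a proper birational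
`τ : Z ⟶ X` with `τ ≫ ξ = ρ`, `Z` integral, such that `I · 𝒪_Z` is an effective Cartier divisor.
Construction: blow `X` up along `I · 𝒪_X ≠ 0` (`β : X₁ ⟶ X`, proper, birational, `X₁` integral), resolve the
excellent two-dimensional `X₁` by CJS (`r : Z ⟶ X₁`), take `τ = r ≫ β`, `ρ = τ ≫ ξ`; `I · 𝒪_{X₁}` is invertible
(blow-up) and stays so on `Z` (`r` dominant between integral schemes).
[cite: CossartJannsenSaito2020, Thm. 1.2] [cite: GortzWedhorn2020, Prop. 13.92] [cite: DeJong1996, 4.10] -/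
theorem exists_isResolution_dominating_of_cjsGeneral (hCJS : CossartJannsenSaito2020General.{0})
    {R : Type} [CommRing R] [IsNoetherianRing R] [IsDomain R] (hRexc : IsExcellentRing R)
    (hdimR : ringKrullDim R ≤ 2) (I : Ideal R) (hI : I ≠ ⊥)
    {X : Scheme.{0}} (ξ : X ⟶ Spec (.of R)) (hξ : IsResolution ξ) :
    ∃ (Z : Scheme.{0}) (_ : IsIntegral Z) (ρ : Z ⟶ Spec (.of R)) (τ : Z ⟶ X),
      IsResolution ρ ∧ τ ≫ ξ = ρ ∧ IsProper τ ∧ IsBirational τ ∧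
        IsEffectiveCartier ((affineBlowup.idealSheaf I).comap ρ) := by
  haveI : IsDomain (CommRingCat.of R) := ‹IsDomain R›
  haveI : IsNoetherianRing (CommRingCat.of R) := ‹IsNoetherianRing R›
  haveI := hξ.isProper
  haveI : IsIntegral X := hξ.isIntegral_source
  haveI : IsDominant ξ := hξ.isBirational.isDominant
  haveI : IsLocallyNoetherian X := LocallyOfFiniteType.isLocallyNoetherian ξ
  -- blow `X` up along `J = I · 𝒪_X ≠ 0`
  set J : X.IdealSheafData := (affineBlowup.idealSheaf I).comap ξ with hJdef
  have hJ : J ≠ ⊥ := comap_ne_bot_of_isDominant ξ hξ.isBirational.isIso_stalkMap_genericPoint I hI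
  obtain ⟨X₁, β, hβ⟩ := exists_isBlowup X J
  haveI : IsProper β := hβ.isProper
  haveI : IsIntegral X₁ := hβ.isIntegral hJ
  have hβbir : IsBirational β := hβ.isBirational' hJ
  -- `X₁` is Noetherian, excellent, of dimension `≤ 2`
  haveI : IsProper (β ≫ ξ) := inferInstance
  haveI : IsLocallyNoetherian X₁ := LocallyOfFiniteType.isLocallyNoetherian (β ≫ ξ)
  haveI : CompactSpace X₁ := QuasiCompact.compactSpace_of_compactSpace (β ≫ ξ)
  haveI : IsNoetherian X₁ := {}
  have hexc : Scheme.IsExcellent X₁ := fun V =>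
    isExcellentRing_sections_of_locallyOfFiniteType (β ≫ ξ)
      (Scheme.isExcellent_Spec_of_isExcellentRing R hRexc) V
  have hdim : topologicalKrullDim X₁ ≤ 2 := by
    rw [(hβbir.comp hξ.isBirational).topologicalKrullDim_eq_of_isProper]
    exact (le_of_eq (PrimeSpectrum.topologicalKrullDim_eq_ringKrullDim (R := R))).trans hdimR
  -- resolve `X₁`
  obtain ⟨Z, r, hr, -⟩ := hCJS X₁ hexc hdim
  haveI := hr.isProper
  haveI : IsIntegral Z := hr.isIntegral_source
  haveI : IsDominant r := hr.isBirational.isDominant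
  refine ⟨Z, inferInstance, (r ≫ β) ≫ ξ, r ≫ β,
    ⟨inferInstance, (hr.isBirational.comp hβbir).comp hξ.isBirational, hr.isRegular⟩, rfl,
    inferInstance, hr.isBirational.comp hβbir, ?_⟩
  -- `I · 𝒪_Z` is the pull-back of the invertible `I · 𝒪_{X₁}` along the dominant `r`
  rw [Scheme.IdealSheafData.comap_comp, Scheme.IdealSheafData.comap_comp]
  exact hβ.isEffectiveCartier.comap_of_isDominant r

end Summit.ResolutionOfSingularities.ResolutionOfSingularities.Theorems.SurfaceTermination.ChartResolution

end
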